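import Summits.QuantumFields.YangMills.Theorems.UnitScaleTiltProp7SectET3HDeltaHOfOpRowsSlotT3
import Summits.QuantumFields.YangMills.Theorems.UnitScaleTiltProp7SectET3DeltaPiT3PInv
import HarnessLib

/-!
# Route `UnitScaleTilt`, crux «MinimiserStabilityRegPr» (stmt-QuantumFields-19200, stub EX), node N06(d = 3), route (α) — LAYER 0, ROWS (def-free):
# **«HDH-HF» — THE (S)-SUB-ROW `hΔH` FOR THE CHART LETTER `Hf …Δx U₀ = η·H(U₀)` ([Balaban1985Variational] (45)) AT A GENERIC HESSIAN SLOT, AND ITS INSTANCE AT THE PINV LETTER OF RECORD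
# `H46ᴾ = Hf …DeltaPiSlotᴾ…` (★★OWNER RULING g28-№4 (C2′), ✓`Prop7SectET3DeltaPiPInv`).**  The two LETTER rows of ✓`Prop7SectET3HDeltaHOfOpRowsSlot.hΔH_of_opRows_slot` are THEOREMS for
# `Hx := Hf …Δx U₀` on the class `PosOnto … Δx U₀` with the slot's Landau guards: (45)₂ `R_SD*(Hf Y) = 0` (✓`RS_DstarL2_HT`) and (137) at the slot `Δx(toL2 (Hf Y)) = η·(Q_k†(QGQ*)⁻¹Ỹ − Q_k†aỸ)`
# (✓`slot_sol_eq` at `x = 0`) — so `hΔH` for `Hf` needs ONLY `hp hkill horth`, (46)₀ `h46`, and the three background rows `h137 hOp139′ hOp349`; at `DeltaPiSlotᴾ` the guards are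
# ✓`DeltaPiSlotP_kills_NS`∕✓`inner_DL2_DeltaPiP_eq_zero` (`0 ≤ a`), leaving `hposπ`-class positivity + the rows — the member text of the h46₂ family door v2

Cell `ym3-torus` (HUMAN RULING D-0037, YM ladder rung R3 — YM₃ on T³, NOT d = 4, NOT Clay; YM gap NOT proved), width seat `ym3-torus-px5` (gen 2; «width 5»; P5 «HDH-PINV» of the PINV
cascade, EX namer ★ym-ust-19200-w2 g6 (G28)).  THEOREMS ONLY (0 `def`, 0 `sorry`); `--supports stmt-QuantumFields-19200 --as helper`; count-neutral; NO claim on crux ∕ stub ∕ registry;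
nothing of [Balaban1985BackgroundPropagators] §3 is asserted.

WHAT IS PROVED (ns `…Theorems.Prop7SectET3HDeltaHOfOpRowsHf`; member `F`, `h : n ≤ K`, weights `c₀ cB a`, slot `Δx`, background `U₀`):
* §1 ★ `landau_Hf` — (45)₂ for the letter at any slot: `R_S(D*(toL2 (Hf …Δx U₀ Y))) = 0` on `PosOnto … Δx U₀` with `horth` (= ✓`landauS_H46`'s proof, slot-generic).
* §1 ★★ `slot_Hf` — (137) AT THE SLOT: `Δx U₀ (toL2 (Hf …Δx U₀ Y)) = η • (Qk†(KinvT …Δx U₀ (toL2B Y)) − Qk†(a • toL2B Y))` on `PosOnto … Δx U₀` with `hkill horth` (✓`slot_sol_eq` at `x = 0`: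
  [Balaban1985BackgroundPropagators] (3.126) `Δ_aH = Q*(QGQ*)⁻¹` minus the (3.26) corrections `DR_SD*H = 0`, `Q*aQH = Q*a`).
* §2 ★★★ `hΔH_Hf_of_opRows` — the two-conjunct `hΔH` text for `Hf …Δx U₀`, `BH″ = c₁₃₇ + k₁₃₉·BH + k₃₄₉·BH + (28 + 4)·ε₀·BH`, from `hreg hp hkill horth h46 h137 hOp139′ hOp349`.
* §3 ★★★ `hΔH_H46P_of_opRows` — THE INSTANCE OF RECORD: the same for `H46ᴾ … U₀` from `(ha : 0 ≤ a) hreg (hp : PosOnto …(DeltaPiSlotᴾ) U₀) h46 h137 hOp139′ hOp349` (guards by P0's rows).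
INHABITABILITY (№9 (3)): no new displayed row — `hp` is the positivity-only `hPosπ` of S9′ (Thm 3.11 for `G`, transported to the pinv letter modulo the finite-rank `ker D` correction —
HONESTY CLAUSE of RULING g28-№4), `h46` is (46)₀ (KH1 lineage), the three background rows are the EX residue-row shapes of record (✓p663021∕✓p668120 docstrings).
HONEST SCOPE.  Two identities of the letter + one composition; nothing of N06(d = 3) proved; not a proof of any stub; nothing continuum ∕ OS ∕ mass-gap ∕ Clay.

References: T. Bałaban, CMP **102** (1985) 277–309 [Balaban1985Variational] ((45)–(46) p.285, (137)–(140) pp.298–299, (19) p.281); CMP **99** (1985) 389–434 [Balaban1985BackgroundPropagators]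
((3.26) p.395, (3.119)–(3.126) pp.419–420).
-/

set_option autoImplicit false

noncomputable section

open scoped InnerProductSpace ComplexConjugate Matrix.Norms.L2Operator

namespace Summit.QuantumFields.YangMills.Theorems.Prop7SectET3HDeltaHOfOpRowsHf

open Literature.MathematicalPhysics.QuantumFieldTheory.Balaban1983to89
open Literature.MathematicalPhysics.QuantumFieldTheory.Balaban1983to89.T3ContinuumYM3Torus
open Literature.MathematicalPhysics.QuantumFieldTheory.Balaban1983to89.T3PrintedRegularMinimiser (RegPr)
open T3SectALandauChart (eta eta_pos covDerivFwdT covCodiffCurlT covLapFormT covDivFormT bgUnits)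
open B9SectCLatticeCarrier (Bond)
open B9Eq311L2Pairing (WL2)
open B11Eq103H1Complex (SiteL2K BondL2K)
open Summit.QuantumFields.YangMills.Theorems.Prop7SectET3Transport (periodsT3)
open Summit.QuantumFields.YangMills.Theorems.Prop7SectET3HilbertLetters (W₂ toL2 toL2S toL2B DL2 DstarL2)
open Summit.QuantumFields.YangMills.Theorems.Prop7SectET3GaugeProjector (NS RS)
open Summit.QuantumFields.YangMills.Theorems.Prop7SectET3WilsonHessian (DeltaEta)
open Summit.QuantumFields.YangMills.Theorems.Prop7SectET3CurvedPropagators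
open Summit.QuantumFields.YangMills.Theorems.Prop7SectET3DeltaPi
open Summit.QuantumFields.YangMills.Theorems.Prop7SectET3DeltaPiPInv (DeltaPiSlotP H46P DeltaPiSlotP_kills_NS inner_DL2_DeltaPiP_eq_zero)
open Summit.QuantumFields.YangMills.Theorems.Prop7HessRowOfEq111 (slot_sol_eq)
open Summit.QuantumFields.YangMills.Theorems.Prop7SectET3HDeltaHOfOpRowsSlot (hΔH_of_opRows_slot)

variable {F : T3Family} {n K : ℕ} {h : n ≤ K} {c₀ cB a : ℝ} [Fact (0 < c₀)] [Fact (0 < cB)]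
  {Δx : GaugeField (F.P K) 0 (Matrix.specialUnitaryGroup (Fin 2) ℂ) → (BondL2K ℂ 3 (periodsT3 F K) c₀ W₂ →ₗ[ℂ] BondL2K ℂ 3 (periodsT3 F K) c₀ W₂)}

/-! ## §1 The two letter rows of `Hf …Δx U₀` are theorems on the class -/

/-- In `L²` the letter is `η·H`: `toL2 (Hf …Δx U₀ Y) = η • HT …Δx U₀ (toL2B Y)`. [cite: Balaban1985Variational, (45) p.285] -/
theorem toL2_Hf (U₀ : GaugeField (F.P K) 0 (Matrix.specialUnitaryGroup (Fin 2) ℂ)) (Y : PBond (F.P n) 0 → Matrix (Fin 2) (Fin 2) ℂ) :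
    toL2 F K c₀ (Hf F n K h c₀ cB a Δx U₀ Y) = (((eta F n K : ℝ) : ℂ)) • HT F n K h c₀ cB a Δx U₀ (toL2B F n cB Y) := by
  rw [Hf_apply, map_smul, LinearEquiv.apply_symm_apply]

/-- ★ **(45)₂ FOR THE LETTER AT ANY SLOT: `R_S(D*_{U₀}(toL2 (Hf …Δx U₀ Y))) = 0`** on `PosOnto … Δx U₀`, given the slot's orthogonality guard `horth` (✓`RS_DstarL2_HT`).
[cite: Balaban1985Variational, (45) p.285; Balaban1985BackgroundPropagators, (3.110) p.417, (3.124) p.420] -/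
theorem landau_Hf {U₀ : GaugeField (F.P K) 0 (Matrix.specialUnitaryGroup (Fin 2) ℂ)} (hp : PosOnto F n K h c₀ cB a Δx U₀)
    (horth : ∀ l ∈ NS F n K h c₀ cB U₀, ∀ w, ⟪DL2 F n K c₀ U₀ l, Δx U₀ w⟫_ℂ = 0) (Y : PBond (F.P n) 0 → Matrix (Fin 2) (Fin 2) ℂ) :
    RS F n K h c₀ cB U₀ (DstarL2 F n K c₀ U₀ (toL2 F K c₀ (Hf F n K h c₀ cB a Δx U₀ Y))) = 0 := by
  rw [toL2_Hf, map_smul, map_smul, RS_DstarL2_HT hp horth, smul_zero]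

/-- ★★ **(137) AT THE SLOT FOR THE LETTER: `Δx U₀ (toL2 (Hf …Δx U₀ Y)) = η • (Q_k†((QGQ*)⁻¹Ỹ) − Q_k†(a·Ỹ))`**, `Ỹ = toL2B Y`, on `PosOnto … Δx U₀` with the guards `hkill horth` — ✓`slot_sol_eq` at `x = 0`
([Balaban1985BackgroundPropagators] (3.126) with the (3.26) corrections: `D R_S D* H = 0`, `Q_k H = 1`). [cite: Balaban1985Variational, (137) p.298; Balaban1985BackgroundPropagators, (3.26) p.395, (3.126) p.420] -/
theorem slot_Hf {U₀ : GaugeField (F.P K) 0 (Matrix.specialUnitaryGroup (Fin 2) ℂ)} (hp : PosOnto F n K h c₀ cB a Δx U₀)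
    (hkill : ∀ l ∈ NS F n K h c₀ cB U₀, Δx U₀ (DL2 F n K c₀ U₀ l) = 0) (horth : ∀ l ∈ NS F n K h c₀ cB U₀, ∀ w, ⟪DL2 F n K c₀ U₀ l, Δx U₀ w⟫_ℂ = 0)
    (Y : PBond (F.P n) 0 → Matrix (Fin 2) (Fin 2) ℂ) :
    Δx U₀ (toL2 F K c₀ (Hf F n K h c₀ cB a Δx U₀ Y))
      = (((eta F n K : ℝ) : ℂ)) • (LinearMap.adjoint (Qk F n K h c₀ cB U₀) (KinvT F n K h c₀ cB a Δx U₀ (toL2B F n cB Y))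
          - LinearMap.adjoint (Qk F n K h c₀ cB U₀) (((a : ℂ)) • toL2B F n cB Y)) := by
  have h0 := slot_sol_eq hp hkill horth 0 (toL2B F n cB Y)
  simp only [map_zero, neg_zero, zero_add, add_zero] at h0
  rw [toL2_Hf, map_smul, h0]

/-! ## §2 `hΔH` for the letter at any slot -/

/-- ★★★ **THE (S)-SUB-ROW `hΔH` FOR `Hf …Δx U₀` AT ANY SLOT** ([Balaban1985Variational] (137)–(140)): both second-order members of (19) for `Hf Y` are `≤ BH″·η³·‖Y‖`,
`BH″ = c₁₃₇ + k₁₃₉·BH + k₃₄₉·BH + (28 + 4)·ε₀·BH`, on `RegPr ε₀ U₀ ∧ PosOnto … Δx U₀` with the guards `hkill horth`, from (46)₀ `h46` and the background rows `h137 hOp139′ hOp349`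
(✓`hΔH_of_opRows_slot` with §1's two letter rows). [cite: Balaban1985Variational, (137)–(140) pp.298–299, (45)–(46) p.285, (19) p.281; Balaban1985BackgroundPropagators, (3.49) p.399] -/
theorem hΔH_Hf_of_opRows {ε₀ : ℝ} {U₀ : GaugeField (F.P K) 0 (Matrix.specialUnitaryGroup (Fin 2) ℂ)} (hreg : RegPr F n K ε₀ U₀) (hε₀ : 0 ≤ ε₀)
    (hp : PosOnto F n K h c₀ cB a Δx U₀)
    (hkill : ∀ l ∈ NS F n K h c₀ cB U₀, Δx U₀ (DL2 F n K c₀ U₀ l) = 0) (horth : ∀ l ∈ NS F n K h c₀ cB U₀, ∀ w, ⟪DL2 F n K c₀ U₀ l, Δx U₀ w⟫_ℂ = 0)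
    {BH c137 k139 k349 : ℝ}
    (h46 : ∀ (Y : PBond (F.P n) 0 → Matrix (Fin 2) (Fin 2) ℂ) (b : PBond (F.P K) 0), ‖Hf F n K h c₀ cB a Δx U₀ Y b‖ ≤ BH * eta F n K * ‖Y‖)
    (h137 : ∀ (Y : PBond (F.P n) 0 → Matrix (Fin 2) (Fin 2) ℂ) (b : PBond (F.P K) 0),
      ‖(toL2 F K c₀).symm (LinearMap.adjoint (Qk F n K h c₀ cB U₀) (KinvT F n K h c₀ cB a Δx U₀ (toL2B F n cB Y))
          - LinearMap.adjoint (Qk F n K h c₀ cB U₀) (((a : ℂ)) • toL2B F n cB Y)) b‖ ≤ c137 * ‖Y‖)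
    (hOp139 : ∀ (X : PBond (F.P K) 0 → Matrix (Fin 2) (Fin 2) ℂ) (s : ℝ), RS F n K h c₀ cB U₀ (DstarL2 F n K c₀ U₀ (toL2 F K c₀ X)) = 0 → (∀ bd, ‖X bd‖ ≤ s) →
      ∀ bd : PBond (F.P K) 0, ‖(toL2 F K c₀).symm (DeltaEta F n K c₀ U₀ (toL2 F K c₀ X) - Δx U₀ (toL2 F K c₀ X)) bd‖ ≤ k139 * s)
    (hOp349 : ∀ (X : PBond (F.P K) 0 → Matrix (Fin 2) (Fin 2) ℂ) (s : ℝ), (∀ bd, ‖X bd‖ ≤ s) → ∀ bd : PBond (F.P K) 0,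
      ‖(toL2 F K c₀).symm (DL2 F n K c₀ U₀ (DstarL2 F n K c₀ U₀ (toL2 F K c₀ X) - RS F n K h c₀ cB U₀ (DstarL2 F n K c₀ U₀ (toL2 F K c₀ X)))) bd‖ ≤ k349 * s) :
    (∀ (Y : PBond (F.P n) 0 → Matrix (Fin 2) (Fin 2) ℂ) (μ : Fin (F.P K).d) (x : Site (F.P K) 0),
        ‖covCodiffCurlT 1 (bgUnits F K U₀) (Hf F n K h c₀ cB a Δx U₀ Y) μ x‖ ≤ (c137 + k139 * BH + k349 * BH + (28 + 4) * ε₀ * BH) * eta F n K ^ 3 * ‖Y‖) ∧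
    (∀ (Y : PBond (F.P n) 0 → Matrix (Fin 2) (Fin 2) ℂ) (ν : Fin (F.P K).d) (x : Site (F.P K) 0),
        ‖covLapFormT 1 (bgUnits F K U₀) (Hf F n K h c₀ cB a Δx U₀ Y) ν x‖ ≤ (c137 + k139 * BH + k349 * BH + (28 + 4) * ε₀ * BH) * eta F n K ^ 3 * ‖Y‖) :=
  hΔH_of_opRows_slot (h := h) hreg (fun Y => Hf F n K h c₀ cB a Δx U₀ Y) hε₀ (landau_Hf hp horth) (slot_Hf hp hkill horth) h46 h137 hOp139 hOp349

/-! ## §3 The instance of record at the PINV letter `H46ᴾ` -/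

/-- ★★★ **`hΔH` FOR THE PINV LETTER OF RECORD `H46ᴾ`** (= `Hf …DeltaPiSlotᴾ…`, ★★OWNER RULING g28-№4 (C2′)): the h46₂ family door v2's member text — both second-order members of (19) for
`H46ᴾ Y` are `≤ BH″·η³·‖Y‖` on `RegPr ε₀ U₀ ∧ PosOnto …(DeltaPiSlotᴾ) U₀` (positivity-only `hPosπ` + ✓`surjective_Qk_of_regPr`), `0 ≤ a`, from `h46 h137 hOp139′ hOp349` — the slot guards are
P0's UNCONDITIONAL ✓`DeltaPiSlotP_kills_NS`∕✓`inner_DL2_DeltaPiP_eq_zero`. [cite: Balaban1985Variational, (137)–(140) pp.298–299, (45)–(46) p.285; Balaban1985BackgroundPropagators, (3.49) p.399, (3.126) p.420] -/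
theorem hΔH_H46P_of_opRows (ha : 0 ≤ a) {ε₀ : ℝ} {U₀ : GaugeField (F.P K) 0 (Matrix.specialUnitaryGroup (Fin 2) ℂ)} (hreg : RegPr F n K ε₀ U₀) (hε₀ : 0 ≤ ε₀)
    (hp : PosOnto F n K h c₀ cB a (DeltaPiSlotP F n K h c₀ cB a) U₀) {BH c137 k139 k349 : ℝ}
    (h46 : ∀ (Y : PBond (F.P n) 0 → Matrix (Fin 2) (Fin 2) ℂ) (b : PBond (F.P K) 0), ‖H46P F n K h c₀ cB a U₀ Y b‖ ≤ BH * eta F n K * ‖Y‖)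
    (h137 : ∀ (Y : PBond (F.P n) 0 → Matrix (Fin 2) (Fin 2) ℂ) (b : PBond (F.P K) 0),
      ‖(toL2 F K c₀).symm (LinearMap.adjoint (Qk F n K h c₀ cB U₀) (KinvT F n K h c₀ cB a (DeltaPiSlotP F n K h c₀ cB a) U₀ (toL2B F n cB Y))
          - LinearMap.adjoint (Qk F n K h c₀ cB U₀) (((a : ℂ)) • toL2B F n cB Y)) b‖ ≤ c137 * ‖Y‖)
    (hOp139 : ∀ (X : PBond (F.P K) 0 → Matrix (Fin 2) (Fin 2) ℂ) (s : ℝ), RS F n K h c₀ cB U₀ (DstarL2 F n K c₀ U₀ (toL2 F K c₀ X)) = 0 → (∀ bd, ‖X bd‖ ≤ s) →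
      ∀ bd : PBond (F.P K) 0, ‖(toL2 F K c₀).symm (DeltaEta F n K c₀ U₀ (toL2 F K c₀ X) - DeltaPiSlotP F n K h c₀ cB a U₀ (toL2 F K c₀ X)) bd‖ ≤ k139 * s)
    (hOp349 : ∀ (X : PBond (F.P K) 0 → Matrix (Fin 2) (Fin 2) ℂ) (s : ℝ), (∀ bd, ‖X bd‖ ≤ s) → ∀ bd : PBond (F.P K) 0,
      ‖(toL2 F K c₀).symm (DL2 F n K c₀ U₀ (DstarL2 F n K c₀ U₀ (toL2 F K c₀ X) - RS F n K h c₀ cB U₀ (DstarL2 F n K c₀ U₀ (toL2 F K c₀ X)))) bd‖ ≤ k349 * s) :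
    (∀ (Y : PBond (F.P n) 0 → Matrix (Fin 2) (Fin 2) ℂ) (μ : Fin (F.P K).d) (x : Site (F.P K) 0),
        ‖covCodiffCurlT 1 (bgUnits F K U₀) (H46P F n K h c₀ cB a U₀ Y) μ x‖ ≤ (c137 + k139 * BH + k349 * BH + (28 + 4) * ε₀ * BH) * eta F n K ^ 3 * ‖Y‖) ∧
    (∀ (Y : PBond (F.P n) 0 → Matrix (Fin 2) (Fin 2) ℂ) (ν : Fin (F.P K).d) (x : Site (F.P K) 0),
        ‖covLapFormT 1 (bgUnits F K U₀) (H46P F n K h c₀ cB a U₀ Y) ν x‖ ≤ (c137 + k139 * BH + k349 * BH + (28 + 4) * ε₀ * BH) * eta F n K ^ 3 * ‖Y‖) :=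
  hΔH_Hf_of_opRows (h := h) hreg hε₀ hp (DeltaPiSlotP_kills_NS ha) (inner_DL2_DeltaPiP_eq_zero ha) h46 h137 hOp139 hOp349

end Summit.QuantumFields.YangMills.Theorems.Prop7SectET3HDeltaHOfOpRowsHf

end
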